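import Summits.BirchSwinnertonDyer.BirchSwinnertonDyer.Theorems.ManinLocalTwoThreeEtaAsymptoticsTwentySeven
import Literature.NumberTheory.ModularForms.DombEtaQuotientCMSigns
import Literature.NumberTheory.ModularForms.QExpansionAlgebra
import Literature.NumberTheory.EllipticCurves.KleinJIntegralQExpansion
import Literature.NumberTheory.EllipticCurves.ModularCurveEtaQuotientsProofs
import HarnessLib

/-!
# (T3) at level 27: the Ligozat cubic `x³ − u² − 9u − 27 → 0` at `i∞` (cell bsd-f2-manin, route `ManinLocalTwoThree`, C3)

The third of the three `q`-asymptotics to which p3 gen 22 reduced the FACT-FREE `|c| = 1` on `X₀(27)`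
(`EtaIdentityReduction.abs_maninConstant_eq_one_twentySeven_of_tendsto (hT1) (hT2) (hT3)`):

  (T3) `x(τ)³ − u(τ)² − 9u(τ) − 27 → 0` as `τ → i∞`,
  `x = η(9τ)⁴/(η(3τ)η(27τ)³) = etaQuotient 27 (expFn [(3,-1),(9,4),(27,-3)])`,
  `u = η(3τ)³/η(27τ)³ = etaQuotient 27 (expFn [(3,3),(27,-3)])`.

Proof (p3's "products only" trick): with `q = e^{2πiτ}` and the Euler functions `E_δ = ∏ (1 − q^{δn})`,
`x = q⁻² E₉⁴/(E₃E₂₇³)`, `u = q⁻³ E₃³/E₂₇³` (`etaQuotient_eq_cexp_mul_eulerUnit`), so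
`x³ − u² − 9u − 27 = F/(q⁶ E₃³ E₂₇⁹)` with the HOLOMORPHIC, `1`-periodic, bounded
`F = E₉¹² − E₃⁹E₂₇³ − 9q³E₃⁶E₂₇⁶ − 27q⁶E₃³E₂₇⁹`; since `E₉ ≡ E₂₇ ≡ 1` and `E₃ ≡ 1 − q³ − q⁶ (mod q⁹)` the
`q`-expansion of `F` is divisible by `q⁷` (indeed `q⁹`: `1 − e⁹ − 9q³e⁶ − 27q⁶e³ = q⁹·R(q)` for `e = 1 − q³ − q⁶`, an
explicit polynomial identity), hence `F/q⁶ → 0` (`EtaAsymptotics.tendsto_div_qParam_pow_of_qExpansion_coeff_eq_zero`)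
and `E₃³E₂₇⁹ → 1`.

Main result: `tendsto_ligozat_cubic_twentySeven` (= hypothesis `hT3` verbatim).  Fact-free, sorry-free.  (T1), (T2) are NOT
proved here; `|c| = 1` at `N = 27` therefore still waits on them; C2/C3 OPEN as filed (⟸ CDT); BSD not proved.
-/

set_option autoImplicit false
set_option linter.dupNamespace false

noncomputable section

open Complex Filter Topology Set Asymptotics PowerSeries
open UpperHalfPlane hiding I
open scoped Real Topology Manifold MatrixGroups
open Literature.NumberTheory.EllipticCurves Literature.NumberTheory.EllipticCurves.ModularForms
open Literature.NumberTheory.ModularForms (eulerUnit etaQuotient_eq_cexp_mul_eulerUnit)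
open Literature.NumberTheory.ModularForms.QExpansionAlgebra

namespace Summit.BirchSwinnertonDyer.BirchSwinnertonDyer.Theorems.ManinLocalTwoThree.EtaCubic

open EtaAsymptotics

/-! ## `q`, and the two `η`-quotients as `q`-powers times Euler functions -/

/-- `e^{2πiτ/24 · (−24k)} = q(τ)^{-k}` (`k : ℕ`). [folklore] -/
theorem cexp_prefactor_eq_inv_pow (τ : ℍ) (k : ℕ) :
    cexp (2 * π * I * (τ : ℂ) / 24 * ((-(24 * (k : ℤ)) : ℤ) : ℂ)) = (Function.Periodic.qParam 1 (τ : ℂ) ^ k)⁻¹ := by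
  rw [Function.Periodic.qParam, ← Complex.exp_nat_mul, ← Complex.exp_neg]
  congr 1
  push_cast
  ring

/-- The divisors of `27`. [folklore] -/
theorem divisors_twentySeven : Nat.divisors 27 = {1, 3, 9, 27} := by decide

/-- **`x = q⁻² · E₃⁻¹ E₉⁴ E₂₇⁻³`.** [cite: Ligozat1975, §3] -/
theorem ligozatX_eq (τ : ℍ) :
    etaQuotient 27 (expFn [(3, -1), (9, 4), (27, -3)]) τ =
      (Function.Periodic.qParam 1 (τ : ℂ) ^ 2)⁻¹ *
        ((eulerFn 3 τ)⁻¹ * eulerFn 9 τ ^ 4 * (eulerFn 27 τ ^ 3)⁻¹) := by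
  have h1 : expFn [(3, -1), (9, 4), (27, -3)] 1 = 0 := by decide
  have h3 : expFn [(3, -1), (9, 4), (27, -3)] 3 = -1 := by decide
  have h9 : expFn [(3, -1), (9, 4), (27, -3)] 9 = 4 := by decide
  have h27 : expFn [(3, -1), (9, 4), (27, -3)] 27 = -3 := by decide
  rw [etaQuotient_eq_cexp_mul_eulerUnit, eulerUnit, divisors_twentySeven]
  rw [Finset.sum_insert (by decide), Finset.sum_insert (by decide), Finset.sum_insert (by decide),
    Finset.sum_singleton, Finset.prod_insert (by decide), Finset.prod_insert (by decide),
    Finset.prod_insert (by decide), Finset.prod_singleton, h1, h3, h9, h27]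
  have hsum : ((1 : ℕ) : ℤ) * 0 + (((3 : ℕ) : ℤ) * -1 + (((9 : ℕ) : ℤ) * 4 + ((27 : ℕ) : ℤ) * -3)) = -(24 * ((2 : ℕ) : ℤ)) := by
    norm_num
  rw [hsum, cexp_prefactor_eq_inv_pow τ 2, zpow_zero, one_mul, zpow_neg, zpow_one,
    show (4 : ℤ) = ((4 : ℕ) : ℤ) by rfl, zpow_natCast, zpow_neg, show (3 : ℤ) = ((3 : ℕ) : ℤ) by rfl, zpow_natCast]
  ring

/-- **`u = q⁻³ · E₃³ E₂₇⁻³`.** [cite: Ligozat1975, §3] -/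
theorem ligozatU_eq (τ : ℍ) :
    etaQuotient 27 (expFn [(3, 3), (27, -3)]) τ =
      (Function.Periodic.qParam 1 (τ : ℂ) ^ 3)⁻¹ * (eulerFn 3 τ ^ 3 * (eulerFn 27 τ ^ 3)⁻¹) := by
  have h1 : expFn [(3, 3), (27, -3)] 1 = 0 := by decide
  have h3 : expFn [(3, 3), (27, -3)] 3 = 3 := by decide
  have h9 : expFn [(3, 3), (27, -3)] 9 = 0 := by decide
  have h27 : expFn [(3, 3), (27, -3)] 27 = -3 := by decide
  rw [etaQuotient_eq_cexp_mul_eulerUnit, eulerUnit, divisors_twentySeven]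
  rw [Finset.sum_insert (by decide), Finset.sum_insert (by decide), Finset.sum_insert (by decide),
    Finset.sum_singleton, Finset.prod_insert (by decide), Finset.prod_insert (by decide),
    Finset.prod_insert (by decide), Finset.prod_singleton, h1, h3, h9, h27]
  have hsum : ((1 : ℕ) : ℤ) * 0 + (((3 : ℕ) : ℤ) * 3 + (((9 : ℕ) : ℤ) * 0 + ((27 : ℕ) : ℤ) * -3)) = -(24 * ((3 : ℕ) : ℤ)) := by
    norm_num
  rw [hsum, cexp_prefactor_eq_inv_pow τ 3, zpow_zero, one_mul, zpow_zero, one_mul,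
    show (3 : ℤ) = ((3 : ℕ) : ℤ) by rfl, zpow_natCast, zpow_neg, zpow_natCast]

/-! ## The holomorphic numerator `F` -/

/- Below, the numerator `F = E₉¹² − E₃⁹E₂₇³ − 9q³E₃⁶E₂₇⁶ − 27q⁶E₃³E₂₇⁹` is always spelled out as the function
`(eulerFn 9 ^ 12 - eulerFn 3 ^ 9 * eulerFn 27 ^ 3 - 9 • (q ^ 3 * eulerFn 3 ^ 6 * eulerFn 27 ^ 6) - 27 • (q ^ 6 * eulerFn 3 ^ 3 * eulerFn 27 ^ 9))`. -/

/-- "Nice" (1-periodic, holomorphic, bounded at `i∞`) for the Euler functions. [folklore] -/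
theorem nice_eulerFn {δ : ℕ} (hδ : 0 < δ) :
    Function.Periodic (eulerFn δ ∘ ofComplex) 1 ∧ MDiff (eulerFn δ) ∧ IsBoundedAtImInfty (eulerFn δ) :=
  ⟨periodic_eulerFn δ, mdifferentiable_eulerFn δ, isBoundedAtImInfty_eulerFn hδ⟩

/-- "Nice" for `q`. [folklore] -/
theorem nice_qParam :
    Function.Periodic ((fun τ : ℍ ↦ Function.Periodic.qParam 1 (τ : ℂ)) ∘ ofComplex) 1 ∧
      MDiff (fun τ : ℍ ↦ Function.Periodic.qParam 1 (τ : ℂ)) ∧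
      IsBoundedAtImInfty (fun τ : ℍ ↦ Function.Periodic.qParam 1 (τ : ℂ)) :=
  ⟨periodic_qParam_one, mdifferentiable_qParam_one, isBoundedAtImInfty_qParam_one⟩

/-- `F` is nice. [folklore] -/
theorem nice_F : Function.Periodic ((eulerFn 9 ^ 12 - eulerFn 3 ^ 9 * eulerFn 27 ^ 3
      - (9 : ℂ) • ((fun τ : ℍ ↦ Function.Periodic.qParam 1 (τ : ℂ)) ^ 3 * eulerFn 3 ^ 6 * eulerFn 27 ^ 6)
      - (27 : ℂ) • ((fun τ : ℍ ↦ Function.Periodic.qParam 1 (τ : ℂ)) ^ 6 * eulerFn 3 ^ 3 * eulerFn 27 ^ 9) : ℍ → ℂ) ∘ ofComplex) 1 ∧ MDiff (eulerFn 9 ^ 12 - eulerFn 3 ^ 9 * eulerFn 27 ^ 3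
      - (9 : ℂ) • ((fun τ : ℍ ↦ Function.Periodic.qParam 1 (τ : ℂ)) ^ 3 * eulerFn 3 ^ 6 * eulerFn 27 ^ 6)
      - (27 : ℂ) • ((fun τ : ℍ ↦ Function.Periodic.qParam 1 (τ : ℂ)) ^ 6 * eulerFn 3 ^ 3 * eulerFn 27 ^ 9) : ℍ → ℂ) ∧ IsBoundedAtImInfty (eulerFn 9 ^ 12 - eulerFn 3 ^ 9 * eulerFn 27 ^ 3
      - (9 : ℂ) • ((fun τ : ℍ ↦ Function.Periodic.qParam 1 (τ : ℂ)) ^ 3 * eulerFn 3 ^ 6 * eulerFn 27 ^ 6)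
      - (27 : ℂ) • ((fun τ : ℍ ↦ Function.Periodic.qParam 1 (τ : ℂ)) ^ 6 * eulerFn 3 ^ 3 * eulerFn 27 ^ 9) : ℍ → ℂ) := by
  have h3 := nice_eulerFn (δ := 3) (by norm_num)
  have h9 := nice_eulerFn (δ := 9) (by norm_num)
  have h27 := nice_eulerFn (δ := 27) (by norm_num)
  exact nice_sub (nice_sub (nice_sub (nice_pow h9 12) (nice_mul (nice_pow h3 9) (nice_pow h27 3)))
    (nice_smul 9 (nice_mul (nice_mul (nice_pow nice_qParam 3) (nice_pow h3 6)) (nice_pow h27 6))))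
    (nice_smul 27 (nice_mul (nice_mul (nice_pow nice_qParam 6) (nice_pow h3 3)) (nice_pow h27 9)))

/-- **The `q`-expansion of `F`** in terms of those of `E₃, E₉, E₂₇` and `X`. [folklore] -/
theorem qExpansion_F :
    qExpansion 1 (eulerFn 9 ^ 12 - eulerFn 3 ^ 9 * eulerFn 27 ^ 3
      - (9 : ℂ) • ((fun τ : ℍ ↦ Function.Periodic.qParam 1 (τ : ℂ)) ^ 3 * eulerFn 3 ^ 6 * eulerFn 27 ^ 6)
      - (27 : ℂ) • ((fun τ : ℍ ↦ Function.Periodic.qParam 1 (τ : ℂ)) ^ 6 * eulerFn 3 ^ 3 * eulerFn 27 ^ 9) : ℍ → ℂ) = qExpansion 1 (eulerFn 9) ^ 12 - qExpansion 1 (eulerFn 3) ^ 9 * qExpansion 1 (eulerFn 27) ^ 3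
      - (9 : ℂ) • (X ^ 3 * qExpansion 1 (eulerFn 3) ^ 6 * qExpansion 1 (eulerFn 27) ^ 6)
      - (27 : ℂ) • (X ^ 6 * qExpansion 1 (eulerFn 3) ^ 3 * qExpansion 1 (eulerFn 27) ^ 9) := by
  have h3 := nice_eulerFn (δ := 3) (by norm_num)
  have h9 := nice_eulerFn (δ := 9) (by norm_num)
  have h27 := nice_eulerFn (δ := 27) (by norm_num)
  have hq := nice_qParam
  rw [qExpansion_sub_of_nice one_pos (nice_sub (nice_sub (nice_pow h9 12) (nice_mul (nice_pow h3 9) (nice_pow h27 3)))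
    (nice_smul 9 (nice_mul (nice_mul (nice_pow hq 3) (nice_pow h3 6)) (nice_pow h27 6))))
    (nice_smul 27 (nice_mul (nice_mul (nice_pow hq 6) (nice_pow h3 3)) (nice_pow h27 9))),
    qExpansion_sub_of_nice one_pos (nice_sub (nice_pow h9 12) (nice_mul (nice_pow h3 9) (nice_pow h27 3)))
      (nice_smul 9 (nice_mul (nice_mul (nice_pow hq 3) (nice_pow h3 6)) (nice_pow h27 6))),
    qExpansion_sub_of_nice one_pos (nice_pow h9 12) (nice_mul (nice_pow h3 9) (nice_pow h27 3)),
    qExpansion_smul_of_nice one_pos 9 (nice_mul (nice_mul (nice_pow hq 3) (nice_pow h3 6)) (nice_pow h27 6)),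
    qExpansion_smul_of_nice one_pos 27 (nice_mul (nice_mul (nice_pow hq 6) (nice_pow h3 3)) (nice_pow h27 9)),
    qExpansion_mul_of_nice one_pos (nice_mul (nice_pow hq 3) (nice_pow h3 6)) (nice_pow h27 6),
    qExpansion_mul_of_nice one_pos (nice_mul (nice_pow hq 6) (nice_pow h3 3)) (nice_pow h27 9),
    qExpansion_mul_of_nice one_pos (nice_pow hq 3) (nice_pow h3 6),
    qExpansion_mul_of_nice one_pos (nice_pow hq 6) (nice_pow h3 3),
    qExpansion_mul_of_nice one_pos (nice_pow h3 9) (nice_pow h27 3),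
    qExpansion_pow_of_nice one_pos h9, qExpansion_pow_of_nice one_pos h3, qExpansion_pow_of_nice one_pos h3,
    qExpansion_pow_of_nice one_pos h3, qExpansion_pow_of_nice one_pos h27, qExpansion_pow_of_nice one_pos h27,
    qExpansion_pow_of_nice one_pos h27, qExpansion_pow_of_nice one_pos hq, qExpansion_pow_of_nice one_pos hq,
    qExpansion_qParam]

/-! ## Divisibility of the `q`-expansions by `X⁷` -/

/-- `X^δ ∣ (q-expansion of E_δ) − 1`. [folklore] -/
theorem X_pow_dvd_qExpansion_eulerFn_sub_one {δ : ℕ} (hδ : 0 < δ) :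
    (X : PowerSeries ℂ) ^ δ ∣ qExpansion 1 (eulerFn δ) - 1 := by
  rw [PowerSeries.X_pow_dvd_iff]
  intro m hm
  rw [map_sub, PowerSeries.coeff_one]
  rcases Nat.eq_zero_or_pos m with rfl | hm0
  · rw [if_pos rfl, (isIntUnitQExp_eulerFn hδ).coeff_zero, sub_self]
  · rw [if_neg hm0.ne', sub_zero]
    exact qExpansion_eulerFn_coeff_of_not_dvd hδ (Nat.not_dvd_of_pos_of_lt hm0 hm)

/-- The `q`-coefficient `6` of `E₃` is `−1` (`∏ (1 − Xⁿ) = 1 − X − X² + ⋯`). [folklore] -/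
theorem qExpansion_eulerFn_three_coeff_six : (qExpansion 1 (eulerFn 3)).coeff 6 = -1 := by
  rw [qExpansion_eulerFn (by norm_num : 0 < 3), coeff_map, coeff_formalEulerScaled,
    if_pos (by norm_num : 3 ∣ 6), show 6 / 3 = 2 by rfl, coeff_formalEulerPow (le_refl 2), eulerTrunc,
    Finset.prod_range_succ, Finset.prod_range_one, zero_add, pow_one, pow_one, pow_one]
  have : ((1 - X) * (1 - X ^ 2) : PowerSeries ℤ) = 1 - X - X ^ 2 + X ^ 3 := by ring
  rw [this]
  simp [PowerSeries.coeff_X_pow, PowerSeries.coeff_X, PowerSeries.coeff_one]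

/-- `X⁹ ∣ (q-expansion of E₃) − (1 − X³ − X⁶)`. [folklore] -/
theorem X_pow_dvd_qExpansion_eulerFn_three_sub :
    (X : PowerSeries ℂ) ^ 9 ∣ qExpansion 1 (eulerFn 3) - (1 - X ^ 3 - X ^ 6) := by
  rw [PowerSeries.X_pow_dvd_iff]
  intro m hm
  have h0 : (qExpansion 1 (eulerFn 3)).coeff 0 = 1 := (isIntUnitQExp_eulerFn (by norm_num : 0 < 3)).coeff_zero
  have hnd : ∀ i, ¬ 3 ∣ i → (qExpansion 1 (eulerFn 3)).coeff i = 0 := fun i hi ↦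
    qExpansion_eulerFn_three_coeff_of_not_dvd hi
  have h3 := qExpansion_eulerFn_three_coeff_three
  have h6 := qExpansion_eulerFn_three_coeff_six
  simp only [map_sub, PowerSeries.coeff_one, PowerSeries.coeff_X_pow]
  interval_cases m
  · simp [h0]
  · simp [hnd 1 (by norm_num)]
  · simp [hnd 2 (by norm_num)]
  · simp [h3]
  · simp [hnd 4 (by norm_num)]
  · simp [hnd 5 (by norm_num)]
  · simp [h6]
  · simp [hnd 7 (by norm_num)]
  · simp [hnd 8 (by norm_num)]

/-- The explicit polynomial identity: `1 − e⁹ − 9X³e⁶ − 27X⁶e³ = X⁹·R(X)` for `e = 1 − X³ − X⁶`. [folklore] -/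
theorem key_polynomial_identity {S : Type*} [CommRing S] (X : S) :
    1 - (1 - X ^ 3 - X ^ 6) ^ 9 - 9 * X ^ 3 * (1 - X ^ 3 - X ^ 6) ^ 6 - 27 * X ^ 6 * (1 - X ^ 3 - X ^ 6) ^ 3 =
      X ^ 9 * (12 + 9 * X ^ 6 - 72 * X ^ 9 + 90 * X ^ 15 - 95 * X ^ 18 - 27 * X ^ 21 + 207 * X ^ 24
        + 72 * X ^ 27 - 135 * X ^ 30 - 90 * X ^ 33 + 12 * X ^ 36 + 27 * X ^ 39 + 9 * X ^ 42 + X ^ 45) := by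
  ring

/-- **`X⁷` divides the `q`-expansion of `F`.** [folklore] -/
theorem X_pow_seven_dvd_qExpansion_F : (X : PowerSeries ℂ) ^ 7 ∣ qExpansion 1 (eulerFn 9 ^ 12 - eulerFn 3 ^ 9 * eulerFn 27 ^ 3
      - (9 : ℂ) • ((fun τ : ℍ ↦ Function.Periodic.qParam 1 (τ : ℂ)) ^ 3 * eulerFn 3 ^ 6 * eulerFn 27 ^ 6)
      - (27 : ℂ) • ((fun τ : ℍ ↦ Function.Periodic.qParam 1 (τ : ℂ)) ^ 6 * eulerFn 3 ^ 3 * eulerFn 27 ^ 9) : ℍ → ℂ) := by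
  rw [qExpansion_F]
  set A := qExpansion 1 (eulerFn 9) with hA
  set B := qExpansion 1 (eulerFn 27) with hB
  set C := qExpansion 1 (eulerFn 3) with hC
  set e : PowerSeries ℂ := 1 - X ^ 3 - X ^ 6 with he
  have h79 : (X : PowerSeries ℂ) ^ 7 ∣ X ^ 9 := pow_dvd_pow X (by norm_num)
  have hA1 : (X : PowerSeries ℂ) ^ 7 ∣ A - 1 :=
    (pow_dvd_pow X (by norm_num)).trans (X_pow_dvd_qExpansion_eulerFn_sub_one (δ := 9) (by norm_num))
  have hB1 : (X : PowerSeries ℂ) ^ 7 ∣ B - 1 :=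
    (pow_dvd_pow X (by norm_num)).trans (X_pow_dvd_qExpansion_eulerFn_sub_one (δ := 27) (by norm_num))
  have hCe : (X : PowerSeries ℂ) ^ 7 ∣ C - e := h79.trans X_pow_dvd_qExpansion_eulerFn_three_sub
  -- powers
  have hA12 : (X : PowerSeries ℂ) ^ 7 ∣ A ^ 12 - 1 := by
    simpa only [one_pow] using hA1.trans (sub_dvd_pow_sub_pow A 1 12)
  have hBp : ∀ n : ℕ, (X : PowerSeries ℂ) ^ 7 ∣ B ^ n - 1 := fun n ↦ by
    simpa only [one_pow] using hB1.trans (sub_dvd_pow_sub_pow B 1 n)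
  have hCp : ∀ n : ℕ, (X : PowerSeries ℂ) ^ 7 ∣ C ^ n - e ^ n := fun n ↦ hCe.trans (sub_dvd_pow_sub_pow C e n)
  -- mixed products `C^m B^n − e^m`
  have hCB : ∀ m n : ℕ, (X : PowerSeries ℂ) ^ 7 ∣ C ^ m * B ^ n - e ^ m := fun m n ↦ by
    have : C ^ m * B ^ n - e ^ m = C ^ m * (B ^ n - 1) + (C ^ m - e ^ m) := by ring
    rw [this]
    exact dvd_add (dvd_mul_of_dvd_right (hBp n) _) (hCp m)
  -- the polynomial part
  have hpoly : (X : PowerSeries ℂ) ^ 7 ∣ 1 - e ^ 9 - 9 * X ^ 3 * e ^ 6 - 27 * X ^ 6 * e ^ 3 := by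
    rw [he, key_polynomial_identity]
    exact h79.trans (dvd_mul_right _ _)
  have hsplit : A ^ 12 - C ^ 9 * B ^ 3 - (9 : ℂ) • (X ^ 3 * C ^ 6 * B ^ 6) - (27 : ℂ) • (X ^ 6 * C ^ 3 * B ^ 9) =
      (A ^ 12 - 1) - (C ^ 9 * B ^ 3 - e ^ 9) - 9 * X ^ 3 * (C ^ 6 * B ^ 6 - e ^ 6)
        - 27 * X ^ 6 * (C ^ 3 * B ^ 9 - e ^ 3) + (1 - e ^ 9 - 9 * X ^ 3 * e ^ 6 - 27 * X ^ 6 * e ^ 3) := by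
    simp only [smul_eq_C_mul, map_ofNat]
    ring
  rw [hsplit]
  refine dvd_add (dvd_sub (dvd_sub (dvd_sub hA12 (hCB 9 3)) (dvd_mul_of_dvd_right (hCB 6 6) _))
    (dvd_mul_of_dvd_right (hCB 3 9) _)) hpoly

/-- **`F/q⁶ → 0` at `i∞`.** [folklore] -/
theorem tendsto_F_div_qParam_pow_six :
    Tendsto (fun τ : ℍ ↦ (eulerFn 9 ^ 12 - eulerFn 3 ^ 9 * eulerFn 27 ^ 3
      - (9 : ℂ) • ((fun τ : ℍ ↦ Function.Periodic.qParam 1 (τ : ℂ)) ^ 3 * eulerFn 3 ^ 6 * eulerFn 27 ^ 6)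
      - (27 : ℂ) • ((fun τ : ℍ ↦ Function.Periodic.qParam 1 (τ : ℂ)) ^ 6 * eulerFn 3 ^ 3 * eulerFn 27 ^ 9) : ℍ → ℂ) τ / Function.Periodic.qParam 1 (τ : ℂ) ^ 6) atImInfty (𝓝 0) := by
  have hn := nice_F
  refine tendsto_div_qParam_pow_of_qExpansion_coeff_eq_zero hn.1 hn.2.1 hn.2.2 (m := 6) fun i hi ↦ ?_
  exact (PowerSeries.X_pow_dvd_iff.mp X_pow_seven_dvd_qExpansion_F) i (by omega)

/-! ## (T3) -/

/-- Pointwise: `x³ − u² − 9u − 27 = (F/q⁶) · (E₃³E₂₇⁹)⁻¹`. [cite: Ligozat1975, §3] -/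
theorem ligozat_cubic_eq (τ : ℍ) :
    etaQuotient 27 (expFn [(3, -1), (9, 4), (27, -3)]) τ ^ 3
      - etaQuotient 27 (expFn [(3, 3), (27, -3)]) τ ^ 2
      - 9 * etaQuotient 27 (expFn [(3, 3), (27, -3)]) τ - 27 =
      ((eulerFn 9 ^ 12 - eulerFn 3 ^ 9 * eulerFn 27 ^ 3
      - (9 : ℂ) • ((fun τ : ℍ ↦ Function.Periodic.qParam 1 (τ : ℂ)) ^ 3 * eulerFn 3 ^ 6 * eulerFn 27 ^ 6)
      - (27 : ℂ) • ((fun τ : ℍ ↦ Function.Periodic.qParam 1 (τ : ℂ)) ^ 6 * eulerFn 3 ^ 3 * eulerFn 27 ^ 9) : ℍ → ℂ) τ / Function.Periodic.qParam 1 (τ : ℂ) ^ 6) * (eulerFn 3 τ ^ 3 * eulerFn 27 τ ^ 9)⁻¹ := by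
  have hq : Function.Periodic.qParam 1 (τ : ℂ) ≠ 0 := by
    rw [Function.Periodic.qParam]; exact Complex.exp_ne_zero _
  have h3 := eulerFn_ne_zero (δ := 3) (by norm_num) τ
  have h27 := eulerFn_ne_zero (δ := 27) (by norm_num) τ
  rw [ligozatX_eq, ligozatU_eq]
  simp only [Pi.sub_apply, Pi.mul_apply, Pi.pow_apply, Pi.smul_apply, smul_eq_mul]
  field_simp

/-- **(T3): `x³ − u² − 9u − 27 → 0` at `i∞`** — hypothesis `hT3` of
`EtaIdentityReduction.abs_maninConstant_eq_one_twentySeven_of_tendsto`, verbatim. [cite: Ligozat1975, §3] -/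
theorem tendsto_ligozat_cubic_twentySeven :
    Tendsto (fun τ : ℍ ↦ etaQuotient 27 (expFn [(3, -1), (9, 4), (27, -3)]) τ ^ 3
      - etaQuotient 27 (expFn [(3, 3), (27, -3)]) τ ^ 2
      - 9 * etaQuotient 27 (expFn [(3, 3), (27, -3)]) τ - 27) atImInfty (𝓝 0) := by
  have hE : Tendsto (fun τ : ℍ ↦ (eulerFn 3 τ ^ 3 * eulerFn 27 τ ^ 9)⁻¹) atImInfty (𝓝 1) := by
    have h3 := (isIntUnitQExp_eulerFn (by norm_num : 0 < 3)).tendsto_one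
    have h27 := (isIntUnitQExp_eulerFn (by norm_num : 0 < 27)).tendsto_one
    have := ((h3.pow 3).mul (h27.pow 9)).inv₀ (by norm_num)
    simpa using this
  have h := tendsto_F_div_qParam_pow_six.mul hE
  rw [zero_mul] at h
  exact h.congr fun τ ↦ (ligozat_cubic_eq τ).symm

end Summit.BirchSwinnertonDyer.BirchSwinnertonDyer.Theorems.ManinLocalTwoThree.EtaCubic

end
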